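import Mathlib
import Summits.ValiantsHypothesis.ValiantsHypothesis.Theorems.ProofCarryingSymmetryRestorationQPACFlatten

/-!
# Route ProofCarryingSymmetry — crux `RestorationQP`, line `registered`, rung S3⁗ under stub S2″ (`stub_proofsToACEquiv`), part 3:
the constant-folding normaliser

Rung S3⁗ allows the invariance proofs to use everything but distributivity A6: besides A1–A5 also
the unit laws A7–A9 and the true constant equations A10.  These are absorbed by NORMALISING before
taking AC-classes, with a normal form that keeps the shape of the formula (no re-bracketing, so that
subformulas stay few): in a normal sum the flattened summands contain at most one constant, which
is nonzero and sits as the RIGHT CHILD OF THE ROOT; likewise for products, with a constant `≠ 0, 1`.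

* `asplit a = (p?, c)` — the non-constant part (`none` for a bare constant) and the constant summand
  of `a` read off this shape; `amerge`, `amk` and the smart sum
  `sadd a b = amk (amerge p_a? p_b?) (c_a + c_b)`; the multiplicative analogues `msplit`, `mmerge`,
  `mmk`, `smul` (a constant factor `0` collapses the product to `0`);
* `cnorm F` — the bottom-up normal form; it commutes with renaming (`cnorm_rename`) and preserves
  the computed polynomial (`eval_cnorm`).

The normal forms, the algebra of `sadd`/`smul` modulo AC and the key lemma
`UCEq F G → ACEq (cnorm F) (cnorm G)` are parts 4–5, the size and subformula bookkeeping part 6.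
Everything is elementary and proved; no named facts.
-/

-- single-problem summit: `Summit.ValiantsHypothesis.ValiantsHypothesis.…` is the namespace by design (D-0017)
set_option linter.dupNamespace false

noncomputable section

open scoped Classical

namespace Summit.ValiantsHypothesis.ValiantsHypothesis.Theorems

namespace ACStability

open Literature.Computability.AlgebraicComplexity MvPolynomial

universe u v w

variable {𝔽 : Type u} {X : Type v} {Y : Type w}

/-! ### Constant leaves -/

/-- The constant carried by a leaf `const c`, `none` otherwise. [folklore] -/
def constOf : PIFormula 𝔽 X → Option 𝔽
  | .const c => some c
  | _ => none

/-- Unfolding of `constOf`. [folklore] -/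
@[simp] theorem constOf_const (c : 𝔽) : constOf (.const c : PIFormula 𝔽 X) = some c := rfl
/-- Unfolding of `constOf`. [folklore] -/
@[simp] theorem constOf_var (x : X) : constOf (.var x : PIFormula 𝔽 X) = none := rfl
/-- Unfolding of `constOf`. [folklore] -/
@[simp] theorem constOf_add (F G : PIFormula 𝔽 X) : constOf (.add F G) = none := rfl
/-- Unfolding of `constOf`. [folklore] -/
@[simp] theorem constOf_mul (F G : PIFormula 𝔽 X) : constOf (.mul F G) = none := rfl

/-- `constOf` detects constant leaves. [folklore] -/
theorem constOf_eq_some {F : PIFormula 𝔽 X} {c : 𝔽} : constOf F = some c ↔ F = .const c := by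
  cases F <;> simp

/-- Renaming does not touch constants. [folklore] -/
@[simp] theorem constOf_rename (f : X → Y) (F : PIFormula 𝔽 X) : constOf (F.rename f) = constOf F := by
  cases F <;> rfl

/-! ### Optional non-constant parts (instance-free) -/

/-- Merging two non-constant parts. [folklore] -/
def amerge : Option (PIFormula 𝔽 X) → Option (PIFormula 𝔽 X) → Option (PIFormula 𝔽 X)
  | none, y => y
  | some p, none => some p
  | some p, some q => some (.add p q)

/-- Unfolding of `amerge`. [folklore] -/
@[simp] theorem amerge_none_left (y : Option (PIFormula 𝔽 X)) : amerge none y = y := rfl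
/-- Unfolding of `amerge`. [folklore] -/
@[simp] theorem amerge_some_none (p : PIFormula 𝔽 X) : amerge (some p) none = some p := rfl
/-- Unfolding of `amerge`. [folklore] -/
@[simp] theorem amerge_some_some (p q : PIFormula 𝔽 X) : amerge (some p) (some q) = some (.add p q) := rfl

/-- Merging two non-constant parts. [folklore] -/
def mmerge : Option (PIFormula 𝔽 X) → Option (PIFormula 𝔽 X) → Option (PIFormula 𝔽 X)
  | none, y => y
  | some p, none => some p
  | some p, some q => some (.mul p q)

/-- Unfolding of `mmerge`. [folklore] -/
@[simp] theorem mmerge_none_left (y : Option (PIFormula 𝔽 X)) : mmerge none y = y := rfl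
/-- Unfolding of `mmerge`. [folklore] -/
@[simp] theorem mmerge_some_none (p : PIFormula 𝔽 X) : mmerge (some p) none = some p := rfl
/-- Unfolding of `mmerge`. [folklore] -/
@[simp] theorem mmerge_some_some (p q : PIFormula 𝔽 X) : mmerge (some p) (some q) = some (.mul p q) := rfl

/-- `amerge` commutes with renaming. [folklore] -/
theorem amerge_map (f : X → Y) (x y : Option (PIFormula 𝔽 X)) :
    amerge (x.map (PIFormula.rename f)) (y.map (PIFormula.rename f)) =
      (amerge x y).map (PIFormula.rename f) := by
  cases x <;> cases y <;> rfl

/-- `mmerge` commutes with renaming. [folklore] -/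
theorem mmerge_map (f : X → Y) (x y : Option (PIFormula 𝔽 X)) :
    mmerge (x.map (PIFormula.rename f)) (y.map (PIFormula.rename f)) =
      (mmerge x y).map (PIFormula.rename f) := by
  cases x <;> cases y <;> rfl

/-- The size of an optional part (`none` = `0`). [folklore] -/
def osize : Option (PIFormula 𝔽 X) → ℕ
  | none => 0
  | some p => p.size

/-- Size of a merge. [folklore] -/
theorem osize_amerge_le (x y : Option (PIFormula 𝔽 X)) : osize (amerge x y) ≤ osize x + osize y + 1 := by
  cases x <;> cases y <;> simp [osize, amerge]

/-- Size of a merge. [folklore] -/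
theorem osize_mmerge_le (x y : Option (PIFormula 𝔽 X)) : osize (mmerge x y) ≤ osize x + osize y + 1 := by
  cases x <;> cases y <;> simp [osize, mmerge]

section Defs

variable [CommSemiring 𝔽]

/-! ### The additive shape: `p + c` -/

/-- Splitting a formula according to the additive normal shape: a bare constant `c ↦ (none, c)`,
a sum `p + c` with a constant right child `↦ (some p, c)`, anything else `a ↦ (some a, 0)`.
[folklore] -/
def asplit : PIFormula 𝔽 X → Option (PIFormula 𝔽 X) × 𝔽
  | .const c => (none, c)
  | .add p q =>
    match constOf q with
    | some c => (some p, c)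
    | none => (some (.add p q), 0)
  | F => (some F, 0)

/-- `asplit` of a variable. [folklore] -/
@[simp] theorem asplit_var (x : X) : asplit (.var x : PIFormula 𝔽 X) = (some (.var x), 0) := rfl
/-- `asplit` of a constant. [folklore] -/
@[simp] theorem asplit_const (c : 𝔽) : asplit (.const c : PIFormula 𝔽 X) = (none, c) := rfl
/-- `asplit` of a product. [folklore] -/
@[simp] theorem asplit_mul (p q : PIFormula 𝔽 X) : asplit (.mul p q) = (some (.mul p q), 0) := rfl
/-- `asplit` of a sum with constant right child. [folklore] -/
@[simp] theorem asplit_add_const (p : PIFormula 𝔽 X) (c : 𝔽) : asplit (.add p (.const c)) = (some p, c) := rfl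

/-- `asplit` of a sum whose right child is not a constant. [folklore] -/
theorem asplit_add_of_ne {p q : PIFormula 𝔽 X} (hq : constOf q = none) :
    asplit (.add p q) = (some (.add p q), 0) := by
  cases q with
  | const c => simp at hq
  | _ => rfl

/-- Reassembling a non-constant part and a constant: drop the constant `0`, a bare constant if
there is no non-constant part. [folklore] -/
def amk : Option (PIFormula 𝔽 X) → 𝔽 → PIFormula 𝔽 X
  | none, c => .const c
  | some p, c => if c = 0 then p else .add p (.const c)

/-- Unfolding of `amk`. [folklore] -/
@[simp] theorem amk_none (c : 𝔽) : amk (none : Option (PIFormula 𝔽 X)) c = .const c := rfl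
/-- Unfolding of `amk`. [folklore] -/
@[simp] theorem amk_some_zero (p : PIFormula 𝔽 X) : amk (some p) 0 = p := by simp [amk]
/-- Unfolding of `amk`. [folklore] -/
theorem amk_some_of_ne (p : PIFormula 𝔽 X) {c : 𝔽} (hc : c ≠ 0) : amk (some p) c = .add p (.const c) := by
  simp [amk, hc]

/-- **The smart sum**: merge the non-constant parts, add the constants. [folklore] -/
def sadd (a b : PIFormula 𝔽 X) : PIFormula 𝔽 X :=
  amk (amerge (asplit a).1 (asplit b).1) ((asplit a).2 + (asplit b).2)

/-! ### The multiplicative shape: `p · c` -/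

/-- Splitting a formula according to the multiplicative normal shape: `c ↦ (none, c)`,
`p · c ↦ (some p, c)`, anything else `a ↦ (some a, 1)`. [folklore] -/
def msplit : PIFormula 𝔽 X → Option (PIFormula 𝔽 X) × 𝔽
  | .const c => (none, c)
  | .mul p q =>
    match constOf q with
    | some c => (some p, c)
    | none => (some (.mul p q), 1)
  | F => (some F, 1)

/-- `msplit` of a variable. [folklore] -/
@[simp] theorem msplit_var (x : X) : msplit (.var x : PIFormula 𝔽 X) = (some (.var x), 1) := rfl
/-- `msplit` of a constant. [folklore] -/
@[simp] theorem msplit_const (c : 𝔽) : msplit (.const c : PIFormula 𝔽 X) = (none, c) := rfl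
/-- `msplit` of a sum. [folklore] -/
@[simp] theorem msplit_add (p q : PIFormula 𝔽 X) : msplit (.add p q) = (some (.add p q), 1) := rfl
/-- `msplit` of a product with constant right child. [folklore] -/
@[simp] theorem msplit_mul_const (p : PIFormula 𝔽 X) (c : 𝔽) : msplit (.mul p (.const c)) = (some p, c) := rfl

/-- `msplit` of a product whose right child is not a constant. [folklore] -/
theorem msplit_mul_of_ne {p q : PIFormula 𝔽 X} (hq : constOf q = none) :
    msplit (.mul p q) = (some (.mul p q), 1) := by
  cases q with
  | const c => simp at hq
  | _ => rfl

/-- Reassembling: drop the factor `1`, a bare constant if there is no non-constant part.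
[folklore] -/
def mmk : Option (PIFormula 𝔽 X) → 𝔽 → PIFormula 𝔽 X
  | none, c => .const c
  | some p, c => if c = 1 then p else .mul p (.const c)

/-- Unfolding of `mmk`. [folklore] -/
@[simp] theorem mmk_none (c : 𝔽) : mmk (none : Option (PIFormula 𝔽 X)) c = .const c := rfl
/-- Unfolding of `mmk`. [folklore] -/
@[simp] theorem mmk_some_one (p : PIFormula 𝔽 X) : mmk (some p) 1 = p := by simp [mmk]
/-- Unfolding of `mmk`. [folklore] -/
theorem mmk_some_of_ne (p : PIFormula 𝔽 X) {c : 𝔽} (hc : c ≠ 1) : mmk (some p) c = .mul p (.const c) := by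
  simp [mmk, hc]

/-- **The smart product**: a constant `0` kills the product; otherwise merge the non-constant parts
and multiply the constants. [folklore] -/
def smul (a b : PIFormula 𝔽 X) : PIFormula 𝔽 X :=
  if (msplit a).2 * (msplit b).2 = 0 then .const 0
  else mmk (mmerge (msplit a).1 (msplit b).1) ((msplit a).2 * (msplit b).2)

/-- The smart product when the constants multiply to `0`. [folklore] -/
theorem smul_of_eq_zero {a b : PIFormula 𝔽 X} (h : (msplit a).2 * (msplit b).2 = 0) :
    smul a b = .const 0 := if_pos h

/-- The smart product when the constants do not multiply to `0`. [folklore] -/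
theorem smul_of_ne_zero {a b : PIFormula 𝔽 X} (h : (msplit a).2 * (msplit b).2 ≠ 0) :
    smul a b = mmk (mmerge (msplit a).1 (msplit b).1) ((msplit a).2 * (msplit b).2) := if_neg h

/-! ### The normal form -/

/-- **The constant-folding normal form**: smart sums and products bottom-up. [folklore] -/
def cnorm : PIFormula 𝔽 X → PIFormula 𝔽 X
  | .add F G => sadd (cnorm F) (cnorm G)
  | .mul F G => smul (cnorm F) (cnorm G)
  | F => F

/-- Unfolding of `cnorm`. [folklore] -/
@[simp] theorem cnorm_var (x : X) : cnorm (.var x : PIFormula 𝔽 X) = .var x := rfl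
/-- Unfolding of `cnorm`. [folklore] -/
@[simp] theorem cnorm_const (c : 𝔽) : cnorm (.const c : PIFormula 𝔽 X) = .const c := rfl
/-- Unfolding of `cnorm`. [folklore] -/
@[simp] theorem cnorm_add (F G : PIFormula 𝔽 X) : cnorm (.add F G) = sadd (cnorm F) (cnorm G) := rfl
/-- Unfolding of `cnorm`. [folklore] -/
@[simp] theorem cnorm_mul (F G : PIFormula 𝔽 X) : cnorm (.mul F G) = smul (cnorm F) (cnorm G) := rfl

/-! ### Renaming -/

/-- `asplit` commutes with renaming. [folklore] -/
theorem asplit_rename (f : X → Y) (F : PIFormula 𝔽 X) :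
    asplit (F.rename f) = ((asplit F).1.map (PIFormula.rename f), (asplit F).2) := by
  cases F with
  | var x => rfl
  | const c => rfl
  | mul p q => rfl
  | add p q => cases q <;> rfl

/-- `msplit` commutes with renaming. [folklore] -/
theorem msplit_rename (f : X → Y) (F : PIFormula 𝔽 X) :
    msplit (F.rename f) = ((msplit F).1.map (PIFormula.rename f), (msplit F).2) := by
  cases F with
  | var x => rfl
  | const c => rfl
  | add p q => rfl
  | mul p q => cases q <;> rfl

/-- `amk` commutes with renaming. [folklore] -/
theorem amk_map (f : X → Y) (m : Option (PIFormula 𝔽 X)) (c : 𝔽) :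
    amk (m.map (PIFormula.rename f)) c = (amk m c).rename f := by
  cases m with
  | none => rfl
  | some p =>
    simp only [Option.map_some, amk]
    split_ifs <;> rfl

/-- `mmk` commutes with renaming. [folklore] -/
theorem mmk_map (f : X → Y) (m : Option (PIFormula 𝔽 X)) (c : 𝔽) :
    mmk (m.map (PIFormula.rename f)) c = (mmk m c).rename f := by
  cases m with
  | none => rfl
  | some p =>
    simp only [Option.map_some, mmk]
    split_ifs <;> rfl

/-- The smart sum commutes with renaming. [folklore] -/
theorem sadd_rename (f : X → Y) (a b : PIFormula 𝔽 X) :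
    sadd (a.rename f) (b.rename f) = (sadd a b).rename f := by
  simp only [sadd, asplit_rename, amerge_map, amk_map]

/-- The smart product commutes with renaming. [folklore] -/
theorem smul_rename (f : X → Y) (a b : PIFormula 𝔽 X) :
    smul (a.rename f) (b.rename f) = (smul a b).rename f := by
  simp only [smul, msplit_rename, mmerge_map, mmk_map]
  split_ifs <;> rfl

/-- **The normal form commutes with renaming.** [folklore] -/
theorem cnorm_rename (f : X → Y) (F : PIFormula 𝔽 X) : cnorm (F.rename f) = (cnorm F).rename f := by
  induction F with
  | var x => rfl
  | const c => rfl
  | add F G ihF ihG => simp only [PIFormula.rename, cnorm_add, ihF, ihG, sadd_rename]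
  | mul F G ihF ihG => simp only [PIFormula.rename, cnorm_mul, ihF, ihG, smul_rename]

/-! ### Semantics -/

/-- The value of an optional non-constant summand (`none` = `0`). [folklore] -/
def oevalA : Option (PIFormula 𝔽 X) → MvPolynomial X 𝔽
  | none => 0
  | some p => p.eval

/-- The value of an optional non-constant factor (`none` = `1`). [folklore] -/
def oevalM : Option (PIFormula 𝔽 X) → MvPolynomial X 𝔽
  | none => 1
  | some p => p.eval

/-- A formula is the sum of its additive parts. [folklore] -/
theorem eval_eq_asplit (a : PIFormula 𝔽 X) : a.eval = oevalA (asplit a).1 + C (asplit a).2 := by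
  cases a with
  | var x => simp [oevalA]
  | const c => simp [oevalA]
  | mul p q => simp [oevalA]
  | add p q =>
    cases q with
    | const c => simp [oevalA]
    | _ => simp [oevalA, asplit]

/-- A formula is the product of its multiplicative parts. [folklore] -/
theorem eval_eq_msplit (a : PIFormula 𝔽 X) : a.eval = oevalM (msplit a).1 * C (msplit a).2 := by
  cases a with
  | var x => simp [oevalM]
  | const c => simp [oevalM]
  | add p q => simp [oevalM]
  | mul p q =>
    cases q with
    | const c => simp [oevalM]
    | _ => simp [oevalM, msplit]

/-- Merging adds the values. [folklore] -/
theorem oevalA_amerge (x y : Option (PIFormula 𝔽 X)) : oevalA (amerge x y) = oevalA x + oevalA y := by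
  cases x <;> cases y <;> simp [oevalA, amerge]

/-- Merging multiplies the values. [folklore] -/
theorem oevalM_mmerge (x y : Option (PIFormula 𝔽 X)) : oevalM (mmerge x y) = oevalM x * oevalM y := by
  cases x <;> cases y <;> simp [oevalM, mmerge]

/-- Reassembling computes the sum of the parts. [folklore] -/
theorem eval_amk (m : Option (PIFormula 𝔽 X)) (c : 𝔽) : (amk m c).eval = oevalA m + C c := by
  cases m with
  | none => simp [oevalA]
  | some p =>
    by_cases hc : c = 0
    · subst hc; simp [oevalA]
    · simp [amk_some_of_ne p hc, oevalA]

/-- Reassembling computes the product of the parts. [folklore] -/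
theorem eval_mmk (m : Option (PIFormula 𝔽 X)) (c : 𝔽) : (mmk m c).eval = oevalM m * C c := by
  cases m with
  | none => simp [oevalM]
  | some p =>
    by_cases hc : c = 1
    · subst hc; simp [oevalM]
    · simp [mmk_some_of_ne p hc, oevalM]

/-- **The smart sum computes the sum.** [folklore] -/
theorem eval_sadd (a b : PIFormula 𝔽 X) : (sadd a b).eval = a.eval + b.eval := by
  rw [sadd, eval_amk, oevalA_amerge, eval_eq_asplit a, eval_eq_asplit b, map_add]
  ring

/-- **The smart product computes the product.** [folklore] -/
theorem eval_smul (a b : PIFormula 𝔽 X) : (smul a b).eval = a.eval * b.eval := by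
  have key : a.eval * b.eval =
      oevalM (msplit a).1 * oevalM (msplit b).1 * C ((msplit a).2 * (msplit b).2) := by
    rw [eval_eq_msplit a, eval_eq_msplit b, map_mul]; ring
  by_cases h : (msplit a).2 * (msplit b).2 = 0
  · rw [smul_of_eq_zero h, key, h, map_zero, mul_zero]
    simp
  · rw [smul_of_ne_zero h, eval_mmk, oevalM_mmerge, key]

/-- **Normalising preserves the computed polynomial.** [folklore] -/
theorem eval_cnorm (F : PIFormula 𝔽 X) : (cnorm F).eval = F.eval := by
  induction F with
  | var x => rfl
  | const c => rfl
  | add F G ihF ihG => rw [cnorm_add, eval_sadd, ihF, ihG, PIFormula.eval_add]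
  | mul F G ihF ihG => rw [cnorm_mul, eval_smul, ihF, ihG, PIFormula.eval_mul]

end Defs

end ACStability

open Literature.Computability.AlgebraicComplexity in
/-- **The constant-folding normal form is sound and equivariant** (helper under stub S2″
`stub_proofsToACEquiv`, crux `RestorationQP`, rung S3⁗): over `ℂ`, `cnorm F` computes the same
polynomial as `F`, and `cnorm` commutes with the renamings of the matrix variables by `S_n`.
[folklore] -/
theorem proofsToACEquiv_aux_constNormEval : ∀ (n : ℕ) (σ : Equiv.Perm (Fin n)) (F : PIFormula ℂ (Fin n × Fin n)), (ACStability.cnorm F).eval = F.eval ∧ ACStability.cnorm (F.rename fun x : Fin n × Fin n => σ • x) = (ACStability.cnorm F).rename fun x : Fin n × Fin n => σ • x := by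
  intro n σ F
  exact ⟨ACStability.eval_cnorm F, ACStability.cnorm_rename _ F⟩

end Summit.ValiantsHypothesis.ValiantsHypothesis.Theorems

end
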